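import Literature.Computability.QuantumComplexity.ForrelationDerivativeTables
import Literature.Computability.QuantumComplexity.ForrelationSignTransport

/-!
# Crux `CubicForrelation.NearExactIsExact` (stmt-QuantumAdvantage-14043) — bent-branch reduction lemmas

Line `direct-sum-amplification`, stub `stub_bentSidedBand` (the BENT branch of the non-Maiorana–McFarland
core: a forbidden band `(31/32, θ₂)` for cubic pairs `(f, g)` on `m + m` bits with `g` bent and neither
side MM-shaped). This file does NOT close the stub; it lands the degree-free reduction of the stub to a
pure coding-theory statement about the DUAL of `g`:

* `bb_exists_dual` (A1). Bentness in the stub's form `W_g(x)² = 2ⁿ` for all `x` (`n = m + m`,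
  `W_g(x) = Σ_y (-1)^{g(y)} (-1)^{y·x}`) gives a Boolean dual `d` with `W_g(x) = 2^m · (-1)^{d(x)}`
  (`W_g(x) = ± 2^m` pointwise; `d(x) := [W_g(x) < 0]`); the dual is unique (`bb_dual_unique`).
* `bb_forrelation_eq_of_dual` (A2). For such a `d`: `Φ(f,g) = 1 − 2·#{x : f x ≠ d x}/2ⁿ` EXACTLY
  (`Φ = 2^{-3n/2} Σ_x (-1)^{f(x)} W_g(x)` by `fsum_eq_sum_mul_W`, and `Σ_x (-1)^{f(x)+d(x)} = 2ⁿ − 2·dist(f,d)`).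
  So on the bent branch `Φ(f,g)` is an affine function of the Hamming distance from `f` to the dual, and
  `Φ = 1 ↔ f = d` (`bb_forrelation_eq_one_iff`).
* `bb_band_of_dual_degree` (A3), CONDITIONAL on the Reed–Muller minimum-weight statement (the statement of
  the neighbouring stub `stub_rmWeight`, taken here as an explicit HYPOTHESIS `hR`, never as a fact): if `f`
  and the dual `d` both have algebraic degree `≤ d₀` then `Φ(f,g) = 1 ∨ Φ(f,g) ≤ 1 − 2/2^{d₀}` (the word
  `f ⊕ d` has degree `≤ d₀`, so it is `0` or has weight `≥ 2^{n−d₀}`).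

Consequently the stub is equivalent to: "for cubic `f`, cubic bent `g` with dual `g̃`, neither MM-shaped,
`dist(f, g̃)/2ⁿ ∉ ((1 − θ₂)/2, 1/64)`" (`bb_bent_distance_form`, adapter `bb_band_of_distance`), and by (A3)
it would follow (with `θ₂ = 1`) from `deg g̃ ≤ 6` — which Hou's bound `deg g̃ ≤ (m+3)/2` (Carlet 2021,
Prop. 74; unproved tree fact `carlet2020_prop74_houDualDegree`, NOT used here) supplies exactly for `m ≤ 10`,
i.e. `n ≤ 20` (`bb_band_of_small_m`, with the RM statement and a Hou-type degree bound both as explicit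
hypotheses); the first open case is `n = 22`, `deg g̃ = 7`. The dual pair `(g̃, g)` is exact, so the
derivative Walsh tables transpose (`bb_dwt_transpose_dual`): every column of `T_{g̃}` is a quadratic spectrum.
The open residual `R_bent(θ₂)` is recorded in the docstring of `bb_band_of_distance`.

Sources: O. Rothaus, On "bent" functions, JCTA 20 (1976) (dual of a bent function); S. Aaronson,
A. Ambainis, Forrelation, SIAM J. Comput. 47 (2018) §1.1.1; C. Carlet, Boolean Functions for Cryptography
and Coding Theory, CUP 2021, §6.1 and Thm 7 (RM minimum distance). Everything below is a theorem; axioms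
are the standard three.

Imports: only the `Literature` forrelation files (they bring `forrelation`, `IsDegLeFun`, `signOf`, `twist`,
`DerivativeWalsh.W`); the Theses file `Summits.…Theses.CubicForrelation` is deliberately NOT imported (nothing here
needs the crux declarations), so this module does not depend on route edits of the Theses file.
-/

set_option linter.dupNamespace false -- D-0017: single-problem summit

namespace Summit.QuantumAdvantage.QuantumAdvantage.Theorems.CubicForrelation.NearExactIsExact

open Finset
open Literature.Computability.QuantumComplexity
open Literature.Computability.QuantumComplexity.BuzetChailloux (bxor zeroVec signOf_sq phi_signOf)
open Literature.Computability.QuantumComplexity.DerivativeWalsh (W fsum phi_eq_fsum fsum_eq_sum_mul_W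
  sqrt_two_pow_three_mul)

variable {m : ℕ}

/-! ### (A1) The dual of a bent function -/

/-- A real number whose square is `2^{m+m}` is `± 2^m`. -/
theorem bb_eq_or_eq_neg_of_sq_eq {w : ℝ} (hw : w ^ 2 = (2 : ℝ) ^ (m + m)) :
    w = (2 : ℝ) ^ m ∨ w = -(2 : ℝ) ^ m := by
  have h : w ^ 2 = ((2 : ℝ) ^ m) ^ 2 := by rw [hw, ← pow_mul, show m * 2 = m + m by ring]
  exact sq_eq_sq_iff_eq_or_eq_neg.1 h

/-- **(A1) Bentness gives a Boolean dual.** If `W_g(x)² = 2^{m+m}` for every `x` (the stub's bentness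
hypothesis on `g`), then there is a Boolean function `d` — the dual `g̃` — with
`W_g(x) = 2^m · (-1)^{d(x)}` for every `x` (take `d(x) := [W_g(x) < 0]`). (Rothaus 1976; Carlet 2021 §6.1.) -/
theorem bb_exists_dual {g : (Fin (m + m) → Bool) → Bool}
    (hbent : ∀ x, W (fun y => signOf (g y)) x ^ 2 = (2 : ℝ) ^ (m + m)) :
    ∃ d : (Fin (m + m) → Bool) → Bool, ∀ x, W (fun y => signOf (g y)) x = (2 : ℝ) ^ m * signOf (d x) := by
  refine ⟨fun x => decide (W (fun y => signOf (g y)) x < 0), fun x => ?_⟩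
  show W (fun y => signOf (g y)) x = (2 : ℝ) ^ m * signOf (decide (W (fun y => signOf (g y)) x < 0))
  have hpos : (0 : ℝ) < (2 : ℝ) ^ m := by positivity
  rcases bb_eq_or_eq_neg_of_sq_eq (hbent x) with h | h
  · have : ¬ W (fun y => signOf (g y)) x < 0 := by rw [h]; exact not_lt.2 hpos.le
    rw [decide_eq_false this, h]
    simp [signOf]
  · have : W (fun y => signOf (g y)) x < 0 := by rw [h]; exact neg_lt_zero.2 hpos
    rw [decide_eq_true this, h]
    simp [signOf]

/-- The dual is unique: two Boolean functions with the same sign reading `2^m · (-1)^{d(x)} = W_g(x)` agree. -/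
theorem bb_dual_unique {g d d' : (Fin (m + m) → Bool) → Bool}
    (hd : ∀ x, W (fun y => signOf (g y)) x = (2 : ℝ) ^ m * signOf (d x))
    (hd' : ∀ x, W (fun y => signOf (g y)) x = (2 : ℝ) ^ m * signOf (d' x)) : d = d' := by
  funext x
  have h := (hd x).symm.trans (hd' x)
  have hs : signOf (d x) = signOf (d' x) := mul_left_cancel₀ (by positivity) h
  revert hs
  cases d x <;> cases d' x <;> simp [signOf] <;> norm_num

/-! ### (A2) Forrelation against a bent function is a Hamming distance to the dual -/

/-- `(-1)^{a} (-1)^{b} = 1 − 2·[a ≠ b]` for Boolean `a, b`. -/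
theorem bb_signOf_mul_signOf (a b : Bool) :
    signOf a * signOf b = 1 - 2 * (if a ≠ b then (1 : ℝ) else 0) := by
  cases a <;> cases b <;> simp [signOf] <;> norm_num

/-- `Σ_x (-1)^{f(x)} (-1)^{d(x)} = 2ⁿ − 2·#{x : f x ≠ d x}` on `n = m + m` bits. -/
theorem bb_sum_signOf_mul_signOf (f d : (Fin (m + m) → Bool) → Bool) :
    ∑ x, signOf (f x) * signOf (d x) =
      (2 : ℝ) ^ (m + m) - 2 * ((univ.filter fun x => f x ≠ d x).card : ℝ) := by
  simp_rw [bb_signOf_mul_signOf]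
  rw [sum_sub_distrib, sum_const, card_univ, Fintype.card_fun, Fintype.card_bool, Fintype.card_fin,
    nsmul_eq_mul, mul_one, ← mul_sum, sum_boole]
  push_cast
  ring

/-- **(A2) Forrelation on the bent branch is a distance.** If `W_g(x) = 2^m · (-1)^{d(x)}` for all `x`
(`g` bent with dual `d`), then for EVERY `f`,
`Φ(f,g) = 1 − 2 · #{x : f x ≠ d x} / 2^{m+m}`: the forrelation is `1 − 2·(relative Hamming distance from f
to the dual)`. (Aaronson–Ambainis 2018 §1.1.1 with Rothaus' duality.) -/
theorem bb_forrelation_eq_of_dual (f g d : (Fin (m + m) → Bool) → Bool)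
    (hd : ∀ x, W (fun y => signOf (g y)) x = (2 : ℝ) ^ m * signOf (d x)) :
    forrelation f g = 1 - 2 * ((univ.filter fun x => f x ≠ d x).card : ℝ) / 2 ^ (m + m) := by
  rw [← phi_signOf, phi_eq_fsum, fsum_eq_sum_mul_W]
  simp_rw [hd]
  have e : ∀ x : Fin (m + m) → Bool, signOf (f x) * ((2 : ℝ) ^ m * signOf (d x)) =
      (2 : ℝ) ^ m * (signOf (f x) * signOf (d x)) := fun x => by ring
  simp_rw [e]
  have hsq : Real.sqrt ((2 : ℝ) ^ (m + m)) = (2 : ℝ) ^ m := by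
    rw [pow_add, Real.sqrt_mul_self (by positivity)]
  rw [← mul_sum, bb_sum_signOf_mul_signOf, sqrt_two_pow_three_mul, hsq]
  have h2 : (0 : ℝ) < (2 : ℝ) ^ (m + m) := by positivity
  have h1 : (0 : ℝ) < (2 : ℝ) ^ m := by positivity
  field_simp

/-- On the bent branch, `Φ(f,g) ≤ 1` with equality iff `f` IS the dual. -/
theorem bb_forrelation_eq_one_iff (f g d : (Fin (m + m) → Bool) → Bool)
    (hd : ∀ x, W (fun y => signOf (g y)) x = (2 : ℝ) ^ m * signOf (d x)) :
    forrelation f g = 1 ↔ f = d := by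
  rw [bb_forrelation_eq_of_dual f g d hd]
  have h2 : (0 : ℝ) < (2 : ℝ) ^ (m + m) := by positivity
  constructor
  · intro h
    have hc : ((univ.filter fun x => f x ≠ d x).card : ℝ) = 0 := by
      field_simp at h
      linarith
    have hc' : (univ.filter fun x => f x ≠ d x) = ∅ := card_eq_zero.1 (by exact_mod_cast hc)
    funext x
    by_contra hx
    have : x ∈ (univ.filter fun x => f x ≠ d x) := mem_filter.2 ⟨mem_univ _, hx⟩
    rw [hc'] at this
    exact absurd this (Finset.notMem_empty x)
  · rintro rfl
    simp

/-- The distance from `f` to the dual, bounded through `Φ`: `Φ(f,g) ≥ 1 − 2η ↔ #{f ≠ d} ≤ η·2ⁿ`. -/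
theorem bb_le_forrelation_iff (f g d : (Fin (m + m) → Bool) → Bool)
    (hd : ∀ x, W (fun y => signOf (g y)) x = (2 : ℝ) ^ m * signOf (d x)) (η : ℝ) :
    1 - 2 * η ≤ forrelation f g ↔ ((univ.filter fun x => f x ≠ d x).card : ℝ) ≤ η * 2 ^ (m + m) := by
  rw [bb_forrelation_eq_of_dual f g d hd]
  have h2 : (0 : ℝ) < (2 : ℝ) ^ (m + m) := by positivity
  rw [mul_div_assoc, sub_le_sub_iff_left, mul_le_mul_iff_right₀ (by norm_num : (0 : ℝ) < 2),
    div_le_iff₀ h2]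

/-! ### (A3) The band from a degree bound on the dual (conditional on the RM minimum weight) -/

/-- Degree `≤ d₀` is closed under xor (sum of representing polynomials over `𝔽₂`). -/
theorem bb_isDegLeFun_bxor {n d₀ : ℕ} {f d : (Fin n → Bool) → Bool} (hf : IsDegLeFun d₀ f)
    (hd : IsDegLeFun d₀ d) : IsDegLeFun d₀ (fun x => f x ^^ d x) := by
  obtain ⟨p, hp, hpf⟩ := hf
  obtain ⟨q, hq, hqd⟩ := hd
  refine ⟨p + q, (MvPolynomial.totalDegree_add p q).trans (max_le hp hq), fun x => ?_⟩
  show (f x ^^ d x) = polyPhase (p + q) x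
  rw [hpf, hqd, polyPhase_apply, polyPhase_apply, polyPhase_apply, map_add]
  generalize MvPolynomial.eval (fun j => if x j then (1 : ZMod 2) else 0) p = a
  generalize MvPolynomial.eval (fun j => if x j then (1 : ZMod 2) else 0) q = b
  revert a b
  decide

/-- `{x : f x ⊕ d x = true} = {x : f x ≠ d x}`. -/
theorem bb_filter_bxor_eq (f d : (Fin (m + m) → Bool) → Bool) :
    (univ.filter fun x => (f x ^^ d x) = true) = univ.filter fun x => f x ≠ d x := by
  refine filter_congr fun x _ => ?_
  cases f x <;> cases d x <;> simp

/-- **(A3′) The band from a degree bound on the difference word `f ⊕ d`**, CONDITIONAL on the Reed–Muller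
minimum-weight statement `hR` (= the statement of stub `stub_rmWeight`: a nonzero Boolean function of degree
`≤ d` on `m` bits has weight `≥ 2^{m−d}`, division-free). If `g` is bent with dual `d` and the word `f ⊕ d`
has algebraic degree `≤ d₀`, then `Φ(f,g) = 1` or `Φ(f,g) ≤ 1 − 2/2^{d₀}`: the word vanishes (`f = d`,
`Φ = 1`) or has weight `≥ 2^{n − d₀}` (`Φ ≤ 1 − 2·2^{−d₀}`). This is the form in which Kasami–Tokura-type
information on the word `f ⊕ g̃` enters. (Carlet 2021 Thm 7 + §6.1.) -/
theorem bb_band_of_word_degree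
    (hR : ∀ (m d : ℕ) (e : (Fin m → Bool) → Bool), IsDegLeFun d e → (∃ x, e x = true) →
      2 ^ m ≤ 2 ^ d * (univ.filter fun x => e x = true).card)
    (m d₀ : ℕ) (f g d : (Fin (m + m) → Bool) → Bool) (he : IsDegLeFun d₀ (fun x => f x ^^ d x))
    (hd : ∀ x, W (fun y => signOf (g y)) x = (2 : ℝ) ^ m * signOf (d x)) :
    forrelation f g = 1 ∨ forrelation f g ≤ 1 - 2 / 2 ^ d₀ := by
  by_cases hex : ∃ x, (f x ^^ d x) = true
  · right
    have hw := hR (m + m) d₀ (fun x => f x ^^ d x) he hex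
    rw [bb_filter_bxor_eq] at hw
    have hw' : (2 : ℝ) ^ (m + m) ≤ 2 ^ d₀ * ((univ.filter fun x => f x ≠ d x).card : ℝ) := by
      exact_mod_cast hw
    rw [bb_forrelation_eq_of_dual f g d hd]
    have h2 : (0 : ℝ) < (2 : ℝ) ^ (m + m) := by positivity
    have h0 : (0 : ℝ) < (2 : ℝ) ^ d₀ := by positivity
    rw [mul_div_assoc, sub_le_sub_iff_left, div_eq_mul_one_div (2 : ℝ) (2 ^ d₀),
      mul_le_mul_iff_right₀ (by norm_num : (0 : ℝ) < 2), le_div_iff₀ h2, one_div,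
      inv_mul_le_iff₀ h0]
    exact hw'
  · left
    rw [bb_forrelation_eq_one_iff f g d hd]
    funext x
    by_contra hx
    exact hex ⟨x, by revert hx; cases f x <;> cases d x <;> simp⟩

/-- **(A3) The band from a degree bound on the dual**, CONDITIONAL on the Reed–Muller minimum-weight statement
`hR` (= the statement of stub `stub_rmWeight`). If `g` is bent with dual `d`, and `f`, `d` both have algebraic
degree `≤ d₀`, then `Φ(f,g) = 1` or `Φ(f,g) ≤ 1 − 2/2^{d₀}` (the word `f ⊕ d` has degree `≤ d₀`:
`bb_band_of_word_degree`). With `d₀ = 3, 4, 5, 6` the gap is `(3/4, 1)`, `(7/8, 1)`, `(15/16, 1)`, `(31/32, 1)`.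
(Carlet 2021 Thm 7 + §6.1.) -/
theorem bb_band_of_dual_degree
    (hR : ∀ (m d : ℕ) (e : (Fin m → Bool) → Bool), IsDegLeFun d e → (∃ x, e x = true) →
      2 ^ m ≤ 2 ^ d * (univ.filter fun x => e x = true).card)
    (m d₀ : ℕ) (f g d : (Fin (m + m) → Bool) → Bool) (hf : IsDegLeFun d₀ f) (hdd : IsDegLeFun d₀ d)
    (hd : ∀ x, W (fun y => signOf (g y)) x = (2 : ℝ) ^ m * signOf (d x)) :
    forrelation f g = 1 ∨ forrelation f g ≤ 1 - 2 / 2 ^ d₀ :=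
  bb_band_of_word_degree hR m d₀ f g d (bb_isDegLeFun_bxor hf hdd) hd

/-- **Small dimensions are closed (conditionally).** Conditional on the Reed–Muller minimum-weight statement `hR`
(stub `stub_rmWeight`) and on Hou's bound in the tree's vocabulary `hHou` ("the dual of a cubic bent function on
`m + m` bits has degree `≤ (m+3)/2`"; Carlet 2021 Prop. 74 — an UNPROVED fact, here an explicit hypothesis): for
`m ≤ 10` (`n ≤ 20`) every cubic pair with `g` bent has `Φ = 1 ∨ Φ ≤ 31/32`, because then `deg g̃ ≤ 6`. So the band of
`stub_bentSidedBand` can only be violated from `n = 22` on, with `deg g̃ ≥ 7`. -/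
theorem bb_band_of_small_m
    (hR : ∀ (m d : ℕ) (e : (Fin m → Bool) → Bool), IsDegLeFun d e → (∃ x, e x = true) →
      2 ^ m ≤ 2 ^ d * (univ.filter fun x => e x = true).card)
    (hHou : ∀ (m : ℕ) (g d : (Fin (m + m) → Bool) → Bool), IsDegLeFun 3 g →
      (∀ x, W (fun y => signOf (g y)) x = (2 : ℝ) ^ m * signOf (d x)) → IsDegLeFun ((m + 3) / 2) d)
    (m : ℕ) (hm : m ≤ 10) (f g : (Fin (m + m) → Bool) → Bool) (hf : IsDegLeFun 3 f) (hg : IsDegLeFun 3 g)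
    (hbent : ∀ x, W (fun y => signOf (g y)) x ^ 2 = (2 : ℝ) ^ (m + m)) :
    forrelation f g = 1 ∨ forrelation f g ≤ 31 / 32 := by
  obtain ⟨d, hd⟩ := bb_exists_dual hbent
  have hd6 : IsDegLeFun 6 d := (hHou m g d hg hd).mono (by omega)
  rcases bb_band_of_dual_degree hR m 6 f g d (hf.mono (by norm_num)) hd6 hd with h | h
  · exact Or.inl h
  · right
    norm_num at h
    linarith

/-! ### The stub in distance form -/

/-- **The bent branch in distance form.** Under the stub's bentness hypothesis on `g` there is a dual `d`
with `W_g = 2^m (-1)^d`, and then for every `f` and every `θ`: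
`θ ≤ Φ(f,g) ↔ 2·#{x : f x ≠ d x} ≤ (1 − θ)·2^{m+m}`. So `stub_bentSidedBand` says exactly: for cubic `f`
and cubic bent NON-MM-shaped `g` (and `f` not MM-shaped), the relative distance `dist(f, g̃)/2ⁿ` avoids the
interval `((1 − θ₂)/2, 1/64)`. -/
theorem bb_bent_distance_form {g : (Fin (m + m) → Bool) → Bool}
    (hbent : ∀ x, W (fun y => signOf (g y)) x ^ 2 = (2 : ℝ) ^ (m + m)) :
    ∃ d : (Fin (m + m) → Bool) → Bool, (∀ x, W (fun y => signOf (g y)) x = (2 : ℝ) ^ m * signOf (d x)) ∧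
      ∀ (f : (Fin (m + m) → Bool) → Bool) (θ : ℝ),
        θ ≤ forrelation f g ↔ 2 * ((univ.filter fun x => f x ≠ d x).card : ℝ) ≤ (1 - θ) * 2 ^ (m + m) := by
  obtain ⟨d, hd⟩ := bb_exists_dual hbent
  refine ⟨d, hd, fun f θ => ?_⟩
  have key := bb_le_forrelation_iff f g d hd ((1 - θ) / 2)
  rw [show 1 - 2 * ((1 - θ) / 2) = θ by ring] at key
  rw [key]
  constructor <;> intro h <;> nlinarith [h]

/-- **Adapter for the stub.** To prove the band `Φ(f,g) ≤ 31/32 ∨ θ₂ ≤ Φ(f,g)` for a bent `g` it suffices to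
show, for the dual `d` of `g`: if `2·#{f ≠ d} < 2ⁿ/32` then `2·#{f ≠ d} ≤ (1 − θ₂)·2ⁿ` (`n = m + m`), i.e. the
relative distance `#{f ≠ d}/2ⁿ` avoids the window `((1 − θ₂)/2, 1/64)`. Quantified over cubic `f`, cubic bent
`g` and its dual, with neither `f` nor `g` MM-shaped, the hypothesis `hres` IS the open residual statement
`R_bent(θ₂)` of `stub_bentSidedBand` ("a cubic `f` that is `1/64`-close to the dual of a cubic bent non-MM `g` is
`(1 − θ₂)/2`-close"); this lemma turns any proof of it into the stub, pointwise in `(m, f, g)`. -/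
theorem bb_band_of_distance {θ₂ : ℝ} (f g : (Fin (m + m) → Bool) → Bool)
    (hbent : ∀ x, W (fun y => signOf (g y)) x ^ 2 = (2 : ℝ) ^ (m + m))
    (hres : ∀ d : (Fin (m + m) → Bool) → Bool,
      (∀ x, W (fun y => signOf (g y)) x = (2 : ℝ) ^ m * signOf (d x)) →
      2 * ((univ.filter fun x => f x ≠ d x).card : ℝ) < 2 ^ (m + m) / 32 →
      2 * ((univ.filter fun x => f x ≠ d x).card : ℝ) ≤ (1 - θ₂) * 2 ^ (m + m)) :
    forrelation f g ≤ 31 / 32 ∨ θ₂ ≤ forrelation f g := by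
  obtain ⟨d, hd, hiff⟩ := bb_bent_distance_form hbent
  by_cases hlt : 2 * ((univ.filter fun x => f x ≠ d x).card : ℝ) < 2 ^ (m + m) / 32
  · exact Or.inr ((hiff f θ₂).2 (hres d hd hlt))
  · left
    by_contra hgt
    push Not at hgt hlt
    have h31 := (hiff f (31 / 32)).1 hgt.le
    have hne : forrelation f g ≠ 31 / 32 := ne_of_gt hgt
    apply hne
    rw [bb_forrelation_eq_of_dual f g d hd]
    have h2 : (0 : ℝ) < (2 : ℝ) ^ (m + m) := by positivity
    have heq : 2 * ((univ.filter fun x => f x ≠ d x).card : ℝ) = 2 ^ (m + m) / 32 := by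
      apply le_antisymm _ hlt
      linarith
    field_simp
    linarith

/-- **The stub from the residual, verbatim.** If `R_bent(θ₂)` holds for some `θ₂ > 31/32` — for cubic `f`, cubic
`g` with dual `d` (so `g` is bent), neither `f` nor `g` MM-shaped (no half-dimensional xor-closed `V ∋ 0` along which
all second differences vanish): `2·#{f ≠ d} < 2ⁿ/32 ⇒ 2·#{f ≠ d} ≤ (1 − θ₂)·2ⁿ` — then the registered statement of
`stub_bentSidedBand` follows word for word (via `bb_band_of_distance`). -/
theorem bb_stub_of_residual :
    ∀ (θ : ℝ), 31 / 32 < θ →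
      (∀ (m : ℕ) (f g d : (Fin (m + m) → Bool) → Bool), IsDegLeFun 3 f → IsDegLeFun 3 g →
        ¬ (∃ V : Finset (Fin (m + m) → Bool), zeroVec ∈ V ∧ (∀ x ∈ V, ∀ y ∈ V, bxor x y ∈ V) ∧
          V.card * V.card = 2 ^ (m + m) ∧
          ∀ u ∈ V, ∀ v ∈ V, ∀ y, (f y ^^ f (bxor y u) ^^ f (bxor y v) ^^ f (bxor y (bxor u v))) = false) →
        ¬ (∃ V : Finset (Fin (m + m) → Bool), zeroVec ∈ V ∧ (∀ x ∈ V, ∀ y ∈ V, bxor x y ∈ V) ∧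
          V.card * V.card = 2 ^ (m + m) ∧
          ∀ u ∈ V, ∀ v ∈ V, ∀ y, (g y ^^ g (bxor y u) ^^ g (bxor y v) ^^ g (bxor y (bxor u v))) = false) →
        (∀ x, W (fun y => signOf (g y)) x = (2 : ℝ) ^ m * signOf (d x)) →
        2 * ((univ.filter fun x => f x ≠ d x).card : ℝ) < 2 ^ (m + m) / 32 →
        2 * ((univ.filter fun x => f x ≠ d x).card : ℝ) ≤ (1 - θ) * 2 ^ (m + m)) →
      ∃ θ₂ : ℝ, 31 / 32 < θ₂ ∧ ∀ (m : ℕ) (f g : (Fin (m + m) → Bool) → Bool), IsDegLeFun 3 f → IsDegLeFun 3 g →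
        (∀ x, W (fun y => signOf (g y)) x ^ 2 = (2 : ℝ) ^ (m + m)) →
        ¬ (∃ V : Finset (Fin (m + m) → Bool), zeroVec ∈ V ∧ (∀ x ∈ V, ∀ y ∈ V, bxor x y ∈ V) ∧
          V.card * V.card = 2 ^ (m + m) ∧
          ∀ u ∈ V, ∀ v ∈ V, ∀ y, (f y ^^ f (bxor y u) ^^ f (bxor y v) ^^ f (bxor y (bxor u v))) = false) →
        ¬ (∃ V : Finset (Fin (m + m) → Bool), zeroVec ∈ V ∧ (∀ x ∈ V, ∀ y ∈ V, bxor x y ∈ V) ∧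
          V.card * V.card = 2 ^ (m + m) ∧
          ∀ u ∈ V, ∀ v ∈ V, ∀ y, (g y ^^ g (bxor y u) ^^ g (bxor y v) ^^ g (bxor y (bxor u v))) = false) →
          forrelation f g ≤ 31 / 32 ∨ θ₂ ≤ forrelation f g := by
  intro θ hθ hres
  exact ⟨θ, hθ, fun m f g hf hg hbent hnf hng =>
    bb_band_of_distance f g hbent fun d hd hlt => hres m f g d hf hg hnf hng hd hlt⟩

/-! ### The dual pair is exact: derivative tables transpose -/

/-- The dual itself is exactly forrelated with `g`: `Φ(d, g) = 1`. -/
theorem bb_forrelation_dual_eq_one {g d : (Fin (m + m) → Bool) → Bool}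
    (hd : ∀ x, W (fun y => signOf (g y)) x = (2 : ℝ) ^ m * signOf (d x)) : forrelation d g = 1 :=
  (bb_forrelation_eq_one_iff d g d hd).2 rfl

/-- **Carlet's transposition for the dual pair.** If `g` is bent with dual `d` then the derivative Walsh tables
are transposes: `T_g(u,h) = T_d(h,u)`, i.e. `W_{D_u g}(h) = W_{D_h d}(u)` for all `h, u`
(`DerivativeWalsh.dwt_transpose_of_forrelation_sq_eq_one` on the exact pair `(d, g)`). For CUBIC `g` every
`u`-row of `T_g` is the spectrum of the quadratic `D_u g` (plateaued, dyadic), so every COLUMN of the table of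
the (possibly high-degree) dual `d` is a quadratic spectrum — the structural handle on `R_bent`. (Carlet 2021 §6.1.) -/
theorem bb_dwt_transpose_dual {g d : (Fin (m + m) → Bool) → Bool}
    (hd : ∀ x, W (fun y => signOf (g y)) x = (2 : ℝ) ^ m * signOf (d x)) (h u : Fin (m + m) → Bool) :
    DerivativeWalsh.dwt (fun y => signOf (g y)) u h = DerivativeWalsh.dwt (fun x => signOf (d x)) h u :=
  DerivativeWalsh.dwt_transpose_of_forrelation_sq_eq_one d g (by rw [bb_forrelation_dual_eq_one hd, one_pow]) h u

end Summit.QuantumAdvantage.QuantumAdvantage.Theorems.CubicForrelation.NearExactIsExact
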